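import Mathlib.NumberTheory.Padics.Complex
import Mathlib.NumberTheory.Padics.RingHoms
import Mathlib.NumberTheory.NumberField.Basic
import Mathlib.FieldTheory.Minpoly.IsIntegrallyClosed
import Mathlib.FieldTheory.Normal.Basic
import Mathlib.RingTheory.DedekindDomain.Ideal.Lemmas
import HarnessLib

/-!
# Normalising an embedding `K ↪ ℚ̄_p` on roots of unity of order prime to `p`

Topic `Literature/NumberTheory/GaloisRepresentations`; namespace
`Literature.NumberTheory.GaloisRepresentations`. THEOREMS ONLY.

**The problem.** A prime `v ∣ p` of a number field `K` is induced by an embedding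
`j : K ↪ ℚ̄_p` (`exists_ringHom_padicAlgCl_of_heightOneSpectrum` in the tree), unique only up to
`Gal(ℚ̄_p/ℚ_p)`.  When congruences *modulo `𝔪_{ℤ̄_p}`* produced along one identification (say
`ι : ℚ̄_p ≃ ℂ`) are to be compared with values transported along `j`, the two must agree on the
roots of unity `ζ ∈ K` that carry the data (Teichmüller lifts of characters): `j(ζ)` and the
prescribed `z = ι⁻¹(ζ)` are `m`-th roots of unity in `ℚ̄_p` which are *congruent-compatible*
(every `f ∈ ℤ[X]` has `f(ζ) ∈ v ↔ |f(z)|_p < 1`) but may differ by a Frobenius twist.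

**The resolution proved here** (`p ∤ m`):

* `exists_algEquiv_apply_eq_of_pow_eq_one` — if `y, z ∈ ℚ̄_p` are `m`-th roots of unity,
  `p ∤ m`, and `|f(y)|_p < 1 ↔ |f(z)|_p < 1` for all `f ∈ ℤ[X]`, then `σ y = z` for some
  `σ ∈ Gal(ℚ̄_p/ℚ_p)`.  Proof: let `g = minpoly_{ℤ_p}(y)`, `X^m - 1 = g h`; if `g(z) ≠ 0` then
  `h(z) = 0` and `m z^{m-1} = g(z) h'(z)` forces `|g(z)|_p ≥ 1`, while approximating `g` by
  `f ∈ ℤ[X]` coefficientwise modulo `p` gives `|f(y)|_p < 1`, hence `|f(z)|_p < 1`, hence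
  `|g(z)|_p < 1` — contradiction (this is Hensel's "simple roots stay apart", done by hand); so
  `z` is a `ℚ_p`-conjugate of `y` and Mathlib's `minpoly.exists_algEquiv_of_root'` applies
  (`ℚ̄_p/ℚ_p` is normal).
* `PadicAlgCl.valuation_algEquiv` — `Gal(ℚ̄_p/ℚ_p)` acts by isometries (the norm of `ℚ̄_p` is the spectral
  norm, Mathlib `spectralNorm_eq_of_equiv`).
* `exists_ringHom_padicAlgCl_apply_eq` — consequently an embedding `j : K ↪ ℚ̄_p` inducing `v`
  (`|j(r)|_p ≤ 1` on `𝓞 K`, `< 1` exactly on `v`) can be replaced by one inducing `v` AND sending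
  a given root of unity `ζ ∈ 𝓞 K` of order prime to `p` to any congruence-compatible `m`-th root
  of unity `z ∈ ℚ̄_p`.

This is the standard fact that the embeddings inducing a fixed prime form one
`Gal(ℚ̄_p/ℚ_p)`-orbit together with the unramifiedness of `ℚ_p(μ_m)/ℚ_p`, `p ∤ m` (Neukirch,
*Algebraic Number Theory*, Ch. II (8.1)–(8.2), (7.12)–(7.13)); it is the bookkeeping step that makes
Deligne–Serre-type lifting arguments (eigenvalues in a number field, congruences at a prime `λ`)
expressible through a fixed `ι : ℚ̄_p ≃ ℂ` (e.g. Billerey–Menares, §3.2).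

## References

* J. Neukirch, *Algebraic Number Theory*, Springer (1999), Ch. II (7.12)–(7.13), (8.1)–(8.2).
  [NeukirchANT1999]
* N. Billerey, R. Menares, *Strong modularity of reducible Galois representations*, Trans. AMS
  370 (2018), §3.2. [BillereyMenares2018]
-/

noncomputable section

open Polynomial IsDedekindDomain NumberField

namespace Literature.NumberTheory.GaloisRepresentations

variable {p : ℕ} [Fact p.Prime]

/-! ### Isometries and ultrametric bookkeeping in `ℚ̄_p` -/

/-- **`Gal(ℚ̄_p/ℚ_p)` acts on `ℚ̄_p` by isometries** (the norm of `ℚ̄_p` is the `ℚ_p`-spectral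
norm, which is invariant under `ℚ_p`-automorphisms); private copy of
`Literature.NumberTheory.LFunctions.Dwork.norm_algEquiv_apply` (heavy import avoided). [cite: NeukirchANT1999, Ch. II (7.12)–(7.13) (uniqueness of the extended valuation)] -/
private theorem PadicAlgCl.norm_algEquiv (σ : PadicAlgCl p ≃ₐ[ℚ_[p]] PadicAlgCl p) (x : PadicAlgCl p) :
    ‖σ x‖ = ‖x‖ := by
  rw [← PadicAlgCl.spectralNorm_eq, ← PadicAlgCl.spectralNorm_eq, ← spectralNorm_eq_of_equiv]

/-- `Valued.v (σ x) = Valued.v x` for `σ ∈ Gal(ℚ̄_p/ℚ_p)`. [folklore] -/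
theorem PadicAlgCl.valuation_algEquiv (σ : PadicAlgCl p ≃ₐ[ℚ_[p]] PadicAlgCl p) (x : PadicAlgCl p) :
    Valued.v (σ x) = Valued.v x := by
  rw [PadicAlgCl.valuation_def, PadicAlgCl.valuation_def, ← NNReal.coe_inj, coe_nnnorm,
    coe_nnnorm, PadicAlgCl.norm_algEquiv]

omit [Fact p.Prime] in
/-- A finite sum of elements of norm `< r` has norm `< r` in an ultrametric normed group
(`r > 0`). [folklore] -/
private theorem norm_sum_lt_of_forall_lt {E : Type*} [SeminormedAddCommGroup E]
    [IsUltrametricDist E] {ι : Type*} (s : Finset ι) (f : ι → E) {r : ℝ} (hr : 0 < r)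
    (h : ∀ i ∈ s, ‖f i‖ < r) : ‖∑ i ∈ s, f i‖ < r := by
  classical
  induction s using Finset.induction_on with
  | empty => simpa using hr
  | insert i s hi ih =>
    rw [Finset.sum_insert hi]
    refine (IsUltrametricDist.norm_add_le_max _ _).trans_lt (max_lt (h i (by simp)) ?_)
    exact ih fun j hj => h j (Finset.mem_insert_of_mem hj)

/-- `‖n‖ = 1` in `ℚ̄_p` for `p ∤ n`. [folklore] -/
private theorem norm_natCast_of_not_dvd_padicAlgCl {n : ℕ} (hn : ¬ p ∣ n) : ‖(n : PadicAlgCl p)‖ = 1 := by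
  rw [← map_natCast (algebraMap ℚ_[p] (PadicAlgCl p)) n]
  change ‖((n : ℚ_[p]) : PadicAlgCl p)‖ = 1
  rw [PadicAlgCl.norm_extends, Padic.norm_natCast_eq_one_iff]
  exact (Nat.Prime.coprime_iff_not_dvd Fact.out).2 hn

/-- An `m`-th root of unity has norm `1`. [folklore] -/
private theorem norm_eq_one_of_pow_eq_one_padicAlgCl {x : PadicAlgCl p} {m : ℕ} (hm : 0 < m)
    (hx : x ^ m = 1) : ‖x‖ = 1 := by
  have h : ‖x‖ ^ m = 1 := by rw [← norm_pow, hx, norm_one]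
  exact (pow_eq_one_iff_of_nonneg (norm_nonneg x) hm.ne').1 h

/-! ### Polynomials with `ℤ_p`-coefficients at integral points -/

section IntPoly

/-- `ℤ_p → ℚ_p → ℚ̄_p` (Mathlib's `AlgebraicClosure.instAlgebra` through `ℚ_p`). [folklore] -/
private theorem algebraMap_padicInt_eq (c : ℤ_[p]) :
    algebraMap ℤ_[p] (PadicAlgCl p) c = ((c : ℚ_[p]) : PadicAlgCl p) := by
  rw [IsScalarTower.algebraMap_apply ℤ_[p] ℚ_[p] (PadicAlgCl p)]
  rfl

/-- `ℤ_p` acts faithfully on `ℚ̄_p` (so that Mathlib's `minpoly.isIntegrallyClosed_dvd` applies);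
a theorem, used via `haveI`. [folklore] -/
private theorem faithfulSMul_padicInt : FaithfulSMul ℤ_[p] (PadicAlgCl p) :=
  (faithfulSMul_iff_algebraMap_injective ℤ_[p] (PadicAlgCl p)).2 (by
    rw [IsScalarTower.algebraMap_eq ℤ_[p] ℚ_[p] (PadicAlgCl p)]
    exact (algebraMap ℚ_[p] (PadicAlgCl p)).injective.comp (IsFractionRing.injective ℤ_[p] ℚ_[p]))

/-- `‖c‖ ≤ 1` in `ℚ̄_p` for `c ∈ ℤ_p`. [folklore] -/
private theorem norm_algebraMap_padicInt_le_one (c : ℤ_[p]) :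
    ‖algebraMap ℤ_[p] (PadicAlgCl p) c‖ ≤ 1 := by
  rw [algebraMap_padicInt_eq, PadicAlgCl.norm_extends, PadicInt.padic_norm_e_of_padicInt]
  exact PadicInt.norm_le_one c

/-- A polynomial with `ℤ_p`-coefficients takes values of norm `≤ 1` at points of norm `≤ 1`. [folklore] -/
theorem norm_aeval_padicInt_le_one (q : ℤ_[p][X]) {w : PadicAlgCl p} (hw : ‖w‖ ≤ 1) :
    ‖aeval w q‖ ≤ 1 := by
  rw [aeval_eq_sum_range]
  refine IsUltrametricDist.norm_sum_le_of_forall_le_of_nonneg zero_le_one fun i _ ↦ ?_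
  rw [Algebra.smul_def, norm_mul, norm_pow]
  exact mul_le_one₀ (norm_algebraMap_padicInt_le_one _) (pow_nonneg (norm_nonneg _) _)
    (pow_le_one₀ (norm_nonneg _) hw)

/-- **Integer approximation of a `ℤ_p`-polynomial**: there is `f ∈ ℤ[X]` with
`|f(w) - q(w)|_p < 1` for every `|w|_p ≤ 1`. [folklore] -/
theorem exists_int_poly_norm_sub_aeval_lt_one (q : ℤ_[p][X]) :
    ∃ f : ℤ[X], ∀ w : PadicAlgCl p, ‖w‖ ≤ 1 → ‖aeval w f - aeval w q‖ < 1 := by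
  classical
  -- coefficientwise approximation modulo `p`
  refine ⟨∑ i ∈ Finset.range (q.natDegree + 1), C ((PadicInt.appr (q.coeff i) 1 : ℕ) : ℤ) * X ^ i,
    fun w hw ↦ ?_⟩
  have hq : aeval w q = ∑ i ∈ Finset.range (q.natDegree + 1), q.coeff i • w ^ i :=
    aeval_eq_sum_range w
  rw [hq, map_sum, ← Finset.sum_sub_distrib]
  refine norm_sum_lt_of_forall_lt _ _ zero_lt_one fun i _ ↦ ?_
  rw [map_mul, map_pow, aeval_X, aeval_C, Algebra.smul_def, ← sub_mul, norm_mul, norm_pow]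
  have hdiff : ‖algebraMap ℤ (PadicAlgCl p) ((PadicInt.appr (q.coeff i) 1 : ℕ) : ℤ) -
      algebraMap ℤ_[p] (PadicAlgCl p) (q.coeff i)‖ < 1 := by
    have h1 : algebraMap ℤ (PadicAlgCl p) ((PadicInt.appr (q.coeff i) 1 : ℕ) : ℤ) =
        algebraMap ℤ_[p] (PadicAlgCl p) ((PadicInt.appr (q.coeff i) 1 : ℕ) : ℤ_[p]) := by
      simp
    rw [h1, ← map_sub, algebraMap_padicInt_eq, PadicAlgCl.norm_extends,
      PadicInt.padic_norm_e_of_padicInt]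
    have hspec := PadicInt.appr_spec 1 (q.coeff i)
    rw [pow_one, Ideal.mem_span_singleton] at hspec
    rw [← neg_sub, norm_neg]
    obtain ⟨c, hc⟩ := hspec
    rw [hc, norm_mul, PadicInt.norm_p]
    have hc1 : ‖c‖ ≤ 1 := PadicInt.norm_le_one c
    have hp : (1 : ℝ) < p := by exact_mod_cast (Fact.out : p.Prime).one_lt
    calc (p : ℝ)⁻¹ * ‖c‖ ≤ (p : ℝ)⁻¹ * 1 := by gcongr
      _ < 1 := by rw [mul_one]; exact inv_lt_one_of_one_lt₀ hp
  calc ‖algebraMap ℤ (PadicAlgCl p) ((PadicInt.appr (q.coeff i) 1 : ℕ) : ℤ) -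
        algebraMap ℤ_[p] (PadicAlgCl p) (q.coeff i)‖ * ‖w‖ ^ i
      ≤ ‖algebraMap ℤ (PadicAlgCl p) ((PadicInt.appr (q.coeff i) 1 : ℕ) : ℤ) -
        algebraMap ℤ_[p] (PadicAlgCl p) (q.coeff i)‖ * 1 := by
        gcongr
        exact pow_le_one₀ (norm_nonneg _) hw
    _ < 1 := by rw [mul_one]; exact hdiff

/-- **Conjugacy of congruence-compatible roots of unity.**  Let `y, z ∈ ℚ̄_p` be `m`-th roots of
unity with `p ∤ m` such that `|f(y)|_p < 1 ↔ |f(z)|_p < 1` for every `f ∈ ℤ[X]`.  Then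
`σ y = z` for some `σ ∈ Gal(ℚ̄_p/ℚ_p)` (i.e. `z` is a root of `minpoly_{ℚ_p}(y)`: roots of
`X^m - 1` that are congruent root-by-factor are equal factorwise, as `X^m - 1` is separable
modulo `p`). [cite: NeukirchANT1999, Ch. II (7.12)–(7.13) and (8.2)] -/
theorem exists_algEquiv_apply_eq_of_pow_eq_one {y z : PadicAlgCl p} {m : ℕ} (hm : ¬ p ∣ m)
    (hm0 : 0 < m) (hy : y ^ m = 1) (hz : z ^ m = 1)
    (hmatch : ∀ f : ℤ[X], ‖aeval y f‖ < 1 ↔ ‖aeval z f‖ < 1) :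
    ∃ σ : PadicAlgCl p ≃ₐ[ℚ_[p]] PadicAlgCl p, σ y = z := by
  classical
  haveI := faithfulSMul_padicInt (p := p)
  have hy1 : ‖y‖ = 1 := norm_eq_one_of_pow_eq_one_padicAlgCl hm0 hy
  have hz1 : ‖z‖ = 1 := norm_eq_one_of_pow_eq_one_padicAlgCl hm0 hz
  -- `y` is integral over `ℤ_p`, with minimal polynomial `g` dividing `X^m - 1`
  set P : ℤ_[p][X] := X ^ m - C 1 with hP
  have hPmonic : P.Monic := monic_X_pow_sub_C 1 hm0.ne'
  have hPy : aeval y P = 0 := by simp [hP, hy]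
  have hPz : aeval z P = 0 := by simp [hP, hz]
  have hyint : IsIntegral ℤ_[p] y := ⟨P, hPmonic, by rwa [← aeval_def]⟩
  set g : ℤ_[p][X] := minpoly ℤ_[p] y with hg
  have hgdvd : g ∣ P := minpoly.isIntegrallyClosed_dvd hyint hPy
  obtain ⟨h, hPgh⟩ := hgdvd
  have hgy : aeval y g = 0 := minpoly.aeval ℤ_[p] y
  -- the minimal polynomial over `ℚ_p` is `g`
  have hgQ : minpoly ℚ_[p] y = g.map (algebraMap ℤ_[p] ℚ_[p]) :=
    minpoly.isIntegrallyClosed_eq_field_fractions' ℚ_[p] hyint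
  have hyalg : IsAlgebraic ℚ_[p] y := Algebra.IsAlgebraic.isAlgebraic y
  -- it suffices that `g(z) = 0`
  suffices hgz : aeval z g = 0 by
    refine minpoly.exists_algEquiv_of_root' hyalg ?_
    rw [hgQ, aeval_map_algebraMap]
    exact hgz
  by_contra hgz
  -- then `h(z) = 0`
  have hhz : aeval z h = 0 := by
    have : aeval z g * aeval z h = 0 := by rw [← map_mul, ← hPgh]; exact hPz
    exact (mul_eq_zero.1 this).resolve_left hgz
  -- derivative identity: `m z^{m-1} = g(z) h'(z)`
  have hder : (m : PadicAlgCl p) * z ^ (m - 1) = aeval z g * aeval z (derivative h) := by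
    have h1 : derivative P = derivative g * h + g * derivative h := by
      rw [hPgh, derivative_mul]
    have h2 : derivative P = C (m : ℤ_[p]) * X ^ (m - 1) := by
      rw [hP, derivative_sub, derivative_X_pow, derivative_C, sub_zero]
    have h3 := congrArg (aeval z) (h2.symm.trans h1)
    simp only [map_mul, map_add, aeval_X_pow, map_natCast, hhz, mul_zero, zero_add] at h3
    exact h3
  -- so `|g(z)| ≥ 1`
  have hge : 1 ≤ ‖aeval z g‖ := by
    have hl : ‖(m : PadicAlgCl p) * z ^ (m - 1)‖ = 1 := by
      rw [norm_mul, norm_pow, norm_natCast_of_not_dvd_padicAlgCl hm, hz1, one_pow, mul_one]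
    have hr : ‖aeval z g * aeval z (derivative h)‖ ≤ ‖aeval z g‖ := by
      rw [norm_mul]
      exact mul_le_of_le_one_right (norm_nonneg _)
        (norm_aeval_padicInt_le_one _ hz1.le)
    rw [← hder, hl] at hr
    exact hr
  -- but `|g(z)| < 1` by the matching hypothesis
  obtain ⟨f, hf⟩ := exists_int_poly_norm_sub_aeval_lt_one (p := p) g
  have hfy : ‖aeval y f‖ < 1 := by
    have := hf y hy1.le
    rwa [hgy, sub_zero] at this
  have hfz : ‖aeval z f‖ < 1 := (hmatch f).1 hfy
  have hlt : ‖aeval z g‖ < 1 := by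
    have h1 : aeval z g = aeval z f - (aeval z f - aeval z g) := by ring
    rw [h1]
    have hsub : ∀ a b : PadicAlgCl p, ‖a - b‖ ≤ max ‖a‖ ‖b‖ := fun a b ↦ by
      have h := IsUltrametricDist.norm_add_le_max a (-b)
      rwa [norm_neg, ← sub_eq_add_neg] at h
    exact lt_of_le_of_lt (hsub _ _) (max_lt hfz (hf z hz1.le))
  exact absurd hlt (not_lt.2 hge)

end IntPoly

/-! ### Embeddings of a number field normalised on a root of unity -/

/-- **Normalising an embedding `K ↪ ℚ̄_p` on a root of unity of order prime to `p`.**  Let `v ∣ p`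
be a prime of the number field `K`, `j : K ↪ ℚ̄_p` an embedding inducing `v`
(`|j r|_p ≤ 1` on `𝓞 K`, `< 1` exactly on `v`), `ζ ∈ 𝓞 K` with `ζ^m = 1`, `p ∤ m`, and
`z ∈ ℚ̄_p` with `z^m = 1` compatible with `v`: `f(ζ) ∈ v ↔ |f(z)|_p < 1` for all `f ∈ ℤ[X]`.
Then some embedding `j'` inducing `v` has `j' ζ = z` (`j' = σ ∘ j`, `σ ∈ Gal(ℚ̄_p/ℚ_p)` an
isometry). [cite: NeukirchANT1999, Ch. II (8.1)–(8.2)] -/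
theorem exists_ringHom_padicAlgCl_apply_eq {K : Type*} [Field K] [NumberField K]
    (v : HeightOneSpectrum (𝓞 K)) (j : K →+* PadicAlgCl p)
    (hj1 : ∀ r : 𝓞 K, Valued.v (j r) ≤ 1) (hj2 : ∀ r : 𝓞 K, Valued.v (j r) < 1 ↔ r ∈ v.asIdeal)
    {ζ : 𝓞 K} {m : ℕ} (hm : ¬ p ∣ m) (hm0 : 0 < m) (hζ : ζ ^ m = 1) {z : PadicAlgCl p}
    (hz : z ^ m = 1) (hmatch : ∀ f : ℤ[X], aeval ζ f ∈ v.asIdeal ↔ Valued.v (aeval z f) < 1) :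
    ∃ j' : K →+* PadicAlgCl p, (∀ r : 𝓞 K, Valued.v (j' r) ≤ 1) ∧
      (∀ r : 𝓞 K, Valued.v (j' r) < 1 ↔ r ∈ v.asIdeal) ∧ j' ζ = z := by
  set y : PadicAlgCl p := j ζ with hy
  have hζK : ((ζ : 𝓞 K) : K) ^ m = 1 := by
    have h := congrArg (algebraMap (𝓞 K) K) hζ
    rwa [map_pow, map_one, ← RingOfIntegers.coe_eq_algebraMap] at h
  have hym : y ^ m = 1 := by
    rw [hy, ← map_pow, hζK, map_one]
  have hvlt : ∀ x : PadicAlgCl p, Valued.v x < 1 ↔ ‖x‖ < 1 := fun x ↦ by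
    rw [PadicAlgCl.valuation_def, ← NNReal.coe_lt_coe, coe_nnnorm, NNReal.coe_one]
  -- transport the matching hypothesis to `y`
  have haeval : ∀ f : ℤ[X], aeval y f = j ((aeval ζ f : 𝓞 K) : K) := fun f ↦ by
    rw [hy, RingOfIntegers.coe_eq_algebraMap, RingOfIntegers.coe_eq_algebraMap]
    exact Polynomial.aeval_algHom_apply ((j.comp (algebraMap (𝓞 K) K)).toIntAlgHom) ζ f
  have hmatch' : ∀ f : ℤ[X], ‖aeval y f‖ < 1 ↔ ‖aeval z f‖ < 1 := fun f ↦ by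
    rw [← hvlt, ← hvlt, haeval, hj2, hmatch]
  obtain ⟨σ, hσ⟩ := exists_algEquiv_apply_eq_of_pow_eq_one hm hm0 hym hz hmatch'
  refine ⟨σ.toRingEquiv.toRingHom.comp j, fun r ↦ ?_, fun r ↦ ?_, ?_⟩
  · change Valued.v (σ (j r)) ≤ 1
    rw [PadicAlgCl.valuation_algEquiv]; exact hj1 r
  · change Valued.v (σ (j r)) < 1 ↔ _
    rw [PadicAlgCl.valuation_algEquiv]; exact hj2 r
  · change σ (j ζ) = z
    exact hσ

end Literature.NumberTheory.GaloisRepresentations
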